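import Summits.HodgeConjecture.HodgeConjecture.Theorems.P2StubU2OfLetters            -- ★ the U2′ detection chain's bricks (J1′, S5-fold, CohFormsL2, (D)-letter types)
import Summits.HodgeConjecture.HodgeConjecture.Theorems.P2StubU1RealisationAt         -- ★ U1′ `TowerRealisation.stubU1RealisationAt_holds`
import Summits.HodgeConjecture.HodgeConjecture.Theorems.H413SpectrumInterfacesKernel   -- ★ `occursIn_of_realisedIn`, `omegaIrreducibleOrZero_datum413`
import Summits.HodgeConjecture.HodgeConjecture.Theorems.F0P2dSocketD                   -- ★ (D) `F0P2dSocketD.holCotFormSpectralProjection_holds`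
import Literature.NumberTheory.Automorphic.UnitaryGroupCotangentSpectralProjectionConj -- ★ (D̄) ⇐ (D) `antiholCotFormSpectralProjection_of_hol`
import Literature.NumberTheory.Automorphic.Liu2021.Def411AsPrinted                     -- ★ `IsIrreducibleOrZero`, `isIrreducible_of_nontrivial`
import HarnessLib

/-!
# Crux `H413`, programme P2, sub-line `F0_P2E3ParityRecut` — **stub EB: PIN OCCURRENCE ⇒ AUTOMORPHIC OCCURRENCE of the theta carrier `ω_V(t)`**
# (`StubEBPinToAutomorphic`: if `ω_V(t)` occurs in the pin's `H¹_{B,τ'}(A_∞, ℂ)` then it is the finite component of a discrete automorphic `P ≤ L²(U(V)(F⁺)\U(V)(𝔸_{F⁺}))`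
# of holomorphic or antiholomorphic COTANGENT type at the factor of record)

Cell hodgecm-mathlib (D-0151), FLOOR 0, crux item H413 = stmt-HodgeConjecture-24833; programme P2; sub-line `F0_P2E3ParityRecut` (F0P2-plan (g4) ruling (X3)
2026-08-31T03:57:21Z on F0P2-p04 (g3)'s census: the registered parity letter E3 `P2StubU4OfParity.StubE3OccurrenceParityAt` is CUT into E3♭ (engine, automorphic
currency) + EB + EP + E3fin (in-house); draft skeleton `F0/P2/p04/F0_P2E3ParityRecut.draft.F0P2p04g3.lean` 6f219c97).  Author F0P2-p04 (g3).  THEOREMS ONLY (no `def`,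
no instance, no notation, no named fact, no `sorry`); `--supports stmt-HodgeConjecture-24833 --as helper`; never imports a `Cruxes/…/Lines` module (s380b) — the stub body is
restated VERBATIM (draft :165–179) as the type of `stubEB_holds`.  HC_CM is proved only modulo the printed citations until rung 0 closes; this file discharges no printed
citation — it is the ASSEMBLY of ★ steps 1–4 of the U2′ detection chain (★ `P2StubU2OfLetters.stubU2_of_letters`, F0P2-p03 (g0)) at `σ := ω_V(t)` instead of a `σ` realised in
`cohForms`, so that the ENGINE's parity letter E3♭ can be stated about automorphic representations and not about `H¹` of Shimura varieties.

THE CHAIN (every step a ★ declaration BY NAME):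
0. `OccursInH1 (datum413 …) τ' (ω_V(t))` (`∃ j ≠ 0` into `H¹_{B,τ'}`) + U1′ ★ `TowerRealisation.stubU1RealisationAt_holds` (injective equivariant realisation of `H¹_{B,τ'}` in
   `cohForms (archFactorOf F V)`) ⇒ `OccursIn … (rightRep F V) (cohForms (archFactorOf F V)) (ω_V(t))` (★ `SpectrumInterfaces.occursIn_of_realisedIn`): a NON-ZERO equivariant
   `θ : ω_V(t) → (U(V)(𝔸_{F⁺}) → ℂ²)` valued in `cohForms`;
1. `ω_V(t) ≠ 0` (else `θ = 0`), so [Liu2021, Def. 4.11]'s «irreducible or zero» (route item H411 ★ `H411_proof`, read as ★ `omegaIrreducibleOrZero_datum413`) makes `ω_V(t)`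
   IRREDUCIBLE (★ `isIrreducible_of_nontrivial`), hence SMOOTH in the function model (★ `isSmooth_of_equivariant_of_le_smoothFun`, `cohForms ≤ smoothFun`);
2. an automorphic measure `μA` on the COMPACT quotient exists (★ `F0P3SpectralJunction.exists_isAutomorphicMeasure`, ★ `compactSpace_automorphicQuotient_adelicDatum`, `4 ≤ [F:ℚ]`);
3. J1′ ★ `F0P3SpectralJunction.exists_discreteAutomorphicRep_of_equivariant_cohForms` (over ★ `CohFormsL2.continuous_apply_of_mem_cohForms`): a discrete automorphic `P ≤ L²(μA)` with
   `P.HasFinComponent (ω_V(t))`, not orthogonal to the class of a coordinate of a value `θ w`;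
4. split `θ w ∈ cohForms = holCotForms ⊔ conj holCotForms`; the spectral-projection letters (D) ★ p799091 `F0P2dSocketD.holCotFormSpectralProjection_holds` and (D̄) ★ p794879
   `antiholCotFormSpectralProjection_of_hol` + ★ `exists_ne_zero_containsForm_of_classes` + ★ `orthogonalProjectionOnto_ne_zero` give `P.IsHolCotangentAt ∨ P.IsAntiholCotangentAt` at
   `((archFactorOf F V).ιinf, (archFactorOf F V).Kc)` (steps 1–4 = the body of ★ `stubU2_of_letters` VERBATIM, with its hypotheses `hD`, `hD'` now ★).

## References
* [Liu2021] Y. Liu, Camb. J. Math. 9 (2021) = arXiv:2102.11518: proof of Prop. 4.13 l. 2131–2146, Rem. 4.14, Def. 4.11.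
* [BorelJacquet1979] A. Borel, H. Jacquet, PSPM 33.1 (1979): §4.2, §4.3, §4.6 (discrete spectrum, finite components).
* [BorelWallach2000] A. Borel, N. Wallach, 2nd ed. (2000): VII 3.2 (Matsushima), XIII 1.2.  [Borel1997] A. Borel, CUP 1997: Thm. 2.13, §8.4.
* [GelfandGraevPiatetskiShapiro1969] Ch. 1 §2.3 (`L² = L²_disc` for compact quotient).
-/

set_option autoImplicit false
-- the mandated namespace has the single-problem summit's repeated segment (`HodgeConjecture.HodgeConjecture`)
set_option linter.dupNamespace false

noncomputable section

namespace Summit.HodgeConjecture.HodgeConjecture.Cruxes.H413.F0P2fStubEBPinToAutomorphic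

open scoped TensorProduct Matrix InnerProductSpace ENNReal ComplexOrder
open MeasureTheory
open NumberField NumberField.InfinitePlace IsDedekindDomain
open HodgeCM.Model HodgeCM.Model.LiuIndex HodgeCM.Model.TowerCarrier
open Summit.HodgeConjecture.CorCM.Model
open Literature.AlgebraicGeometry.Motives (CMType AbelianVariety)
open Literature.AlgebraicGeometry.ShimuraVarieties Literature.AlgebraicGeometry.ShimuraVarieties.UnitaryCanonicalModel
open Literature.NumberTheory.Automorphic
open Literature.NumberTheory.Automorphic.Liu2021 Literature.NumberTheory.Automorphic.Liu2021.AppendixC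
open Literature.NumberTheory.GelbartRogawski1991 Literature.NumberTheory.GelbartRogawski1991.UnitaryDualPair
open Literature.RepresentationTheory Literature.RepresentationTheory.Liu2021
open Summit.HodgeConjecture.CorCM
open Literature.NumberTheory.GelbartRogawski1991.OscillatorTripleDictionary (OccursInH1 rhoTriple)
open Literature.Geometry.ComplexHyperbolic.BallModel (U21 x₀)
open Summit.HodgeConjecture.CorCM.Lines.A3Liu413 (datum413)
open Summit.HodgeConjecture.HodgeConjecture.Cruxes.H413.CohFormsCarriers
open Literature.NumberTheory.Automorphic.UnitaryGroup
open Literature.NumberTheory.Automorphic.UnitaryGroup.CotangentForms (toQuotFun cmArchSection cmCompactFactor cohForms_le_smoothFun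
  isSmooth_of_equivariant_of_le_smoothFun holCotFormSpectralProjection antiholCotFormSpectralProjection antiholCotFormSpectralProjection_of_hol)
open Summit.HodgeConjecture.HodgeConjecture.Cruxes.H413.F0P3SpectralJunction
open Summit.HodgeConjecture.HodgeConjecture.Cruxes.H413.F0P3StubS5Fold (two_le_finrank_maximalRealSubfield exists_ne_zero_containsForm_of_classes)
open Summit.HodgeConjecture.HodgeConjecture.Cruxes.H413.F0P3HilbertProjection (orthogonalProjectionOnto_ne_zero)
open Summit.HodgeConjecture.HodgeConjecture.Cruxes.H413.CohFormsL2 (continuous_apply_of_mem_cohForms)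
open Summit.HodgeConjecture.HodgeConjecture.Cruxes.H413.SpectrumJunction (continuous_toQuotFun cohForms_eq_generic compactSpace_automorphicQuotient_adelicDatum)
open Summit.HodgeConjecture.HodgeConjecture.Cruxes.H413.SpectrumInterfaces
open Summit.HodgeConjecture.HodgeConjecture.Cruxes.H413.TowerRealisation (stubU1RealisationAt_holds)
open Summit.HodgeConjecture.HodgeConjecture.Cruxes.H413.F0P2dSocketD (holCotFormSpectralProjection_holds)

/-! ## §1 A non-zero linear map has a non-trivial source -/

/-- If a linear map is non-zero, its source is non-trivial. [folklore] -/
theorem nontrivial_of_linearMap_ne_zero {R M N : Type*} [Semiring R] [AddCommMonoid M] [Module R M] [AddCommMonoid N] [Module R N]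
    {θ : M →ₗ[R] N} (hθ : θ ≠ 0) : Nontrivial M := by
  by_contra h
  rw [not_nontrivial_iff_subsingleton] at h
  exact hθ (LinearMap.ext fun m => by rw [Subsingleton.elim m 0, map_zero, LinearMap.zero_apply])

/-! ## §2 Steps 1–4 of the detection chain for an irreducible `σ` occurring in `cohForms` (the body of ★ `stubU2_of_letters`, letters (D)(D̄) now ★) -/

set_option synthInstance.maxHeartbeats 400000 in
set_option maxHeartbeats 8000000 in
/-- **An irreducible `σ` of `U(V)(𝔸_{F⁺,f})` occurring in `cohForms (archFactorOf F V)` is the finite component of a cotangent-type discrete automorphic `P`.**  For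
`[F:ℚ] ≥ 6` (so `[F:ℚ] ≥ 4` and `[F⁺:ℚ] ≥ 2`): there are an automorphic measure `μA` on `U(V)(F⁺)\U(V)(𝔸_{F⁺})` and a discrete automorphic `P ≤ L²(μA)` with
`P.IsHolCotangentAt ∨ P.IsAntiholCotangentAt` at `((archFactorOf F V).ιinf, (archFactorOf F V).Kc)` and `P.HasFinComponent σ`.  Steps 1–4 of ★
`P2StubU2OfLetters.stubU2_of_letters` VERBATIM with `hD := ★ F0P2dSocketD.holCotFormSpectralProjection_holds`, `hD' := ★ antiholCotFormSpectralProjection_of_hol hD`.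
[cite: BorelJacquet1979, §4.2, §4.6] [cite: Borel1997, Thm. 2.13, §8.4] [cite: Liu2021, proof of Prop. 4.13 l. 2131–2146] -/
theorem exists_cotangentType_hasFinComponent_of_occursIn
    (F : HodgeCM.CMField) [IsGalois ℚ F] (h6 : 6 ≤ Module.finrank ℚ F) {ι₁ : F →+* ℂ} (V : HodgeCM.HermSpace3 F ι₁)
    {W : Type} [AddCommGroup W] [Module ℂ W] (σ : Representation ℂ ↥(HodgeCM.HermSpace3.adelicFin V) W) (hirr : σ.IsIrreducible)
    (θ : W →ₗ[ℂ] ((adelicDatum F V).Adelic → (Fin 2 → ℂ))) (hθ0 : θ ≠ 0) (hθA : ∀ w, θ w ∈ cohForms (archFactorOf F V))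
    (hθσ : ∀ (g : ↥(HodgeCM.HermSpace3.adelicFin V)) (w : W), θ (σ g w) = rightRep F V g (θ w)) :
    ∃ (μA : Measure (adelicDatum F V).automorphicQuotient) (_ : (adelicDatum F V).IsAutomorphicMeasure μA)
      (P : DiscreteAutomorphicRep (adelicDatum F V) μA),
      (P.IsHolCotangentAt (archFactorOf F V).ιinf (archFactorOf F V).Kc ∨
          P.IsAntiholCotangentAt (archFactorOf F V).ιinf (archFactorOf F V).Kc) ∧
        P.HasFinComponent σ := by
  have h4 : 4 ≤ Module.finrank ℚ F := le_trans (by norm_num) h6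
  -- `[F⁺:ℚ] ≥ 2` (`[F:ℚ] = 2 [F⁺:ℚ] ≥ 6`): the «genuine inner form» binder of the letters
  have h2 := two_le_finrank_maximalRealSubfield F h6
  -- the spectral-projection letters, ★ since p799091 ∕ p794879
  have hD : holCotFormSpectralProjection := holCotFormSpectralProjection_holds
  have hD' : antiholCotFormSpectralProjection := antiholCotFormSpectralProjection_of_hol hD
  -- step 2: an automorphic measure on the compact quotient
  obtain ⟨μ, hμ⟩ := exists_isAutomorphicMeasure (V := V) h4
  haveI := hμ
  haveI := compactSpace_automorphicQuotient_adelicDatum F V h4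
  -- step 3: J1′
  obtain ⟨P, w, j, h, hu, hfin⟩ := exists_discreteAutomorphicRep_of_equivariant_cohForms h4 μ (archFactorOf F V)
    (continuous_apply_of_mem_cohForms F V h4) σ hirr θ hθσ hθA hθ0
  -- every coordinate of every cotangent form is `L²` (continuity on the compact quotient)
  have hmem : ∀ f ∈ cohForms (archFactorOf F V), ∀ j : Fin 2, MemLp (toQuotFun (adelicDatum F V) fun x => f x j) 2 μ :=
    fun f hf j => memLp_of_continuous (continuous_toQuotFun (cohForms_left_invariant_apply (archFactorOf F V) hf j) (continuous_apply_of_mem_cohForms F V h4 f hf j))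
  -- step 4: split the value `θ w` along `cohForms = holCotForms ⊔ conj holCotForms`
  obtain ⟨A, hA, B, hB', hAB⟩ := Submodule.mem_sup.mp (hθA w)
  have hAc : A ∈ cohForms (archFactorOf F V) := Submodule.mem_sup_left hA
  have hBc : B ∈ cohForms (archFactorOf F V) := Submodule.mem_sup_right hB'
  have hsum : h.toLp (toQuotFun (adelicDatum F V) fun x => θ w x j) =
      (hmem A hAc j).toLp (toQuotFun (adelicDatum F V) fun x => A x j) +
        (hmem B hBc j).toLp (toQuotFun (adelicDatum F V) fun x => B x j) := by
    rw [← MemLp.toLp_add]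
    exact MemLp.toLp_congr _ _ (Filter.EventuallyEq.of_eq (funext fun y => by simp only [toQuotFun, ← hAB, Pi.add_apply]))
  obtain ⟨u, huP, hne⟩ := hu
  have hsplit : ⟪(u : (adelicDatum F V).L2 μ), (hmem A hAc j).toLp (toQuotFun (adelicDatum F V) fun x => A x j)⟫_ℂ ≠ 0 ∨
      ⟪(u : (adelicDatum F V).L2 μ), (hmem B hBc j).toLp (toQuotFun (adelicDatum F V) fun x => B x j)⟫_ℂ ≠ 0 := by
    by_contra hcon
    push Not at hcon
    apply hne
    rw [hsum, inner_add_right, hcon.1, hcon.2, add_zero]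
  -- the letter (D): the projection onto `P` of the (anti)holomorphic summand is a NON-ZERO (anti)holomorphic cotangent form CONTAINED in `P`
  have htype : P.IsHolCotangentAt (archFactorOf F V).ιinf (archFactorOf F V).Kc ∨
      P.IsAntiholCotangentAt (archFactorOf F V).ιinf (archFactorOf F V).Kc := by
    rcases hsplit with hA1 | hB1
    · left
      obtain ⟨Ψ, hΨ, hΨ', heq⟩ := hD (HodgeCM.CMField.K F) ι₁ (HodgeCM.HermSpace3.Hm V) V.sylvesterFrame (HodgeCM.Model.sylvesterFrame_J V)
        V.posDef_of_ne h2 μ P A hA (hmem A hAc)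
      refine exists_ne_zero_containsForm_of_classes P hΨ hΨ' (fun j' => ?_) ⟨j, ?_⟩
      · rw [← heq j']
        exact Submodule.starProjection_apply_mem _ _
      · rw [← heq j, Submodule.starProjection_apply]
        exact Subtype.coe_ne_coe.mpr (orthogonalProjectionOnto_ne_zero P.space ⟨u, huP, hA1⟩)
    · right
      obtain ⟨Ψ, hΨ, hΨ', heq⟩ := hD' (HodgeCM.CMField.K F) ι₁ (HodgeCM.HermSpace3.Hm V) V.sylvesterFrame (HodgeCM.Model.sylvesterFrame_J V)
        V.posDef_of_ne h2 μ P B hB' (hmem B hBc)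
      refine exists_ne_zero_containsForm_of_classes P hΨ hΨ' (fun j' => ?_) ⟨j, ?_⟩
      · rw [← heq j']
        exact Submodule.starProjection_apply_mem _ _
      · rw [← heq j, Submodule.starProjection_apply]
        exact Subtype.coe_ne_coe.mpr (orthogonalProjectionOnto_ne_zero P.space ⟨u, huP, hB1⟩)
  exact ⟨μ, hμ, P, htype, hfin⟩

/-! ## §3 Stub EB — the closer -/

set_option synthInstance.maxHeartbeats 400000 in
set_option maxHeartbeats 8000000 in
/-- **stub EB — `stubEB_holds : StubEBPinToAutomorphic`** (draft `F0_P2E3ParityRecut` :165–179 VERBATIM): at `n = 3`, for every face (`hDel, F, h6, V, a₀, Φ, hΦ, i`), every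
`τ'` and every adèlic oscillator triple `t` of the printed datum (`μ_t` weight one, `ε_t` global): if `ω_V(t) = rhoTriple (datum413 …) t` occurs in the pin's `H¹_{B,τ'}(A_∞, ℂ)`,
then `ω_V(t)` is the finite component of a discrete automorphic `P ≤ L²(U(V)(F⁺)\U(V)(𝔸_{F⁺}), μA)` of holomorphic or antiholomorphic cotangent type at the factor of record.
Proof: step 0 (★ `occursIn_of_realisedIn` over U1′ ★ `stubU1RealisationAt_holds`), step 1 (`ω_V(t) ≠ 0` by `nontrivial_of_linearMap_ne_zero`; irreducible by ★
`omegaIrreducibleOrZero_datum413` = H411 ★ + ★ `isIrreducible_of_nontrivial`), then §2.  (`t.HasWeightOne` is used for H411; `IsGlobalEps` is not needed and not used.)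
[cite: Liu2021, proof of Prop. 4.13 l. 2131–2146, Rem. 4.14, Def. 4.11] [cite: BorelJacquet1979, §4.6] [cite: BorelWallach2000, VII 3.2] -/
theorem stubEB_holds :
    ∀ (hDel : Literature.AlgebraicGeometry.ShimuraVarieties.UnitaryCanonicalModel.canonicalModel_exists_printed)
    (F : HodgeCM.CMField) [IsGalois ℚ F] (h6 : 6 ≤ Module.finrank ℚ F) {ι₁ : F →+* ℂ} (V : HodgeCM.HermSpace3 F ι₁) (a₀ : RealScalar F)
    (Φ : CMType F) (hΦ : ι₁ ∈ Φ.1) (i : (I V (repAt a₀) (muLiu ι₁ GramClass.rep))),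
    (datum413 hDel F V a₀ Φ i).n = 3 →
      ∀ (τ' : HodgeCM.CMField.K F →+* ℂ) (t : (datum413 hDel F V a₀ Φ i).Triple), t.HasWeightOne →
        IsGlobalEps (datum413 hDel F V a₀ Φ i) t.ε → OccursInH1 (datum413 hDel F V a₀ Φ i) τ' (rhoTriple (datum413 hDel F V a₀ Φ i) t) →
          ∃ (μA : Measure (adelicDatum F V).automorphicQuotient) (_ : (adelicDatum F V).IsAutomorphicMeasure μA)
            (P : DiscreteAutomorphicRep (adelicDatum F V) μA),
            (P.IsHolCotangentAt (archFactorOf F V).ιinf (archFactorOf F V).Kc ∨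
                P.IsAntiholCotangentAt (archFactorOf F V).ιinf (archFactorOf F V).Kc) ∧
              P.HasFinComponent (rhoTriple (datum413 hDel F V a₀ Φ i) t) := by
  intro hDel F _ h6 ι₁ V a₀ Φ hΦ i hn τ' t hw _hε hocc
  -- step 0: occurrence in `cohForms` through the ★ realisation U1′
  obtain ⟨θ, hθ0, hθA, hθσ⟩ := occursIn_of_realisedIn (datum413 hDel F V a₀ Φ i) τ' (rightRep F V) (cohForms (archFactorOf F V))
    (stubU1RealisationAt_holds hDel F h6 V a₀ Φ hΦ i hn τ') (rhoTriple (datum413 hDel F V a₀ Φ i) t) hocc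
  -- step 1: `ω_V(t) ≠ 0`, hence irreducible ([Liu2021, Def. 4.11] «irreducible or zero» = H411 ★)
  haveI := nontrivial_of_linearMap_ne_zero hθ0
  have hirr : (rhoTriple (datum413 hDel F V a₀ Φ i) t).IsIrreducible :=
    isIrreducible_of_nontrivial (omegaIrreducibleOrZero_datum413 hDel F h6 V a₀ Φ hΦ i t hw)
  -- steps 2–4
  exact exists_cotangentType_hasFinComponent_of_occursIn F h6 V (rhoTriple (datum413 hDel F V a₀ Φ i) t) hirr θ hθ0 hθA hθσ

end Summit.HodgeConjecture.HodgeConjecture.Cruxes.H413.F0P2fStubEBPinToAutomorphic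

end
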